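import Summits.ResolutionOfSingularities.ResolutionOfSingularities.Theorems.EquisingularLiftEquisingularLiftNatTowerDriverFour
import Summits.ResolutionOfSingularities.ResolutionOfSingularities.Theorems.EquisingularLiftEquisingularLiftNatTowerRuledPointSteps
import Summits.ResolutionOfSingularities.ResolutionOfSingularities.Theorems.EquisingularLiftEquisingularLiftNatTowerRuledRoots
import Summits.ResolutionOfSingularities.ResolutionOfSingularities.Theorems.EquisingularLiftEquisingularLiftNatTCPlusInvBase
import Summits.ResolutionOfSingularities.ResolutionOfSingularities.Theorems.EquisingularLiftEquisingularLiftNatInvStepRegular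
import Summits.ResolutionOfSingularities.ResolutionOfSingularities.Theorems.EquisingularLiftEquisingularLiftNatInvStepSingular
import Summits.ResolutionOfSingularities.ResolutionOfSingularities.Theorems.EquisingularLiftEquisingularLiftNatTowerSideFacts
import Summits.ResolutionOfSingularities.ResolutionOfSingularities.Theorems.EquisingularLiftEquisingularLiftNatTowerRootsDischarge
import Summits.ResolutionOfSingularities.ResolutionOfSingularities.Theorems.EquisingularLiftEquisingularLiftNatTowerRoundThreeDefs
import Summits.ResolutionOfSingularities.ResolutionOfSingularities.Theorems.EquisingularLiftEquisingularLiftNatRationalCarrierLift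
import Summits.ResolutionOfSingularities.ResolutionOfSingularities.Theorems.EquisingularLiftEquisingularLiftNatCarrierCurveDimension
import Summits.ResolutionOfSingularities.ResolutionOfSingularities.Theorems.EquisingularLiftEquisingularLiftNatTowerCurveStepThree
import Summits.ResolutionOfSingularities.ResolutionOfSingularities.Theorems.EquisingularLiftEquisingularLiftNatTowerConeRoundThree
import Summits.ResolutionOfSingularities.ResolutionOfSingularities.Theorems.EquisingularLiftEquisingularLiftNatTowerConeRoundOldThree
import Summits.ResolutionOfSingularities.ResolutionOfSingularities.Theorems.EquisingularLiftEquisingularLiftNatTowerPtStepsInvThree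
import Summits.ResolutionOfSingularities.ResolutionOfSingularities.Theorems.EquisingularLiftEquisingularLiftNatInvKCLStepRegular
import Summits.ResolutionOfSingularities.ResolutionOfSingularities.Theorems.EquisingularLiftEquisingularLiftNatInvKCLStepSingular
import HarnessLib

/-!
# [OURS · L1 W4.5(b) · EL♮(3)] HSUB′(ReachTower₄)₃ — THE TOWER ASSEMBLY v7: `hsub_reachTower_four_of_kcl` — the (R1) CURRENCY SWITCH
# `INV := (K = ∅ ∧ TCPlus.Inv …) ∨ (TCPlus.InvKCL … ∧ side facts ∧ IsClosed Z)`, `INV₁ := (Tower.Inv₃ … (DirLift.Ruled …) … ∧ side facts) ∧ carrier datum`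
# (crux `EquisingularLiftNatThree` = stmt-ResolutionOfSingularities-20148, parent stmt-…-20038; registered stub `stub_elnat_coneTowerPointResolution`
# @ `ReachTower₄` (TARGET-CONETOWER4 070981bcd9f54dfd), closer `stub_elnat_coneTowerPointResolution_of_subchainLift₄` (res-L1-w45b-lead-2 p569465);
# res-L1-w45b-plan-1 DESK WORD 2026-08-27T21:42:53Z «018 → TOWER₄ v7 PREP = the (R1) currency switch on top of …V6c»; res-L1-w45b-stub-4 BRICK MAP 21:53:06Z)

res-D-pv-018 g5. OURS; NOT a statement of any manuscript; AI-written, weaker than expert review. No `sorry`; standard axioms. DEF-FREE.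
`--supports stmt-ResolutionOfSingularities-20148 --as helper`. Pattern (E): named stand-ins, shrinking as bricks land.

WHY v7 (res-type-100 S7 FINDING 20:46:11Z / res-D-pv-029 DECISION 20:53:20Z, …NatSubchainSupplierInvKDefs p570160 §(vii-loc)): the GLOBAL exact shadow trace
(vii) of `TCPlus.MemberKC` (and (k-ii) of `Tower.Shadow₂`) is NOT suppliable at the `ConeForm` seed, so v6.2's S7 `hBaseKC` (conclusion `TCPlus.InvKC`) was a
stand-in nobody can discharge; every use of the trace in the tower is local near the carrier. v7 = v6.2 (…NatTowerAssemblyV6c p574576, this seat) VERBATIM — same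
statement binders, same eight bullets, same in-file derivation of input (c) (2-frames via res-L1-w45b-stub-3 `forall_exists_twoFrame_of_model_of_carrier` + the
carrier datum PROVED from clause (v) + T-DIM) — with exactly these token swaps:
* `INV`: `TCPlus.InvKC ↦ TCPlus.InvKCL` and one more side conjunct `IsClosed Z` (the KCL steps read it); `INV₁`: `Tower.Inv₂ ↦ Tower.Inv₃`;
* (base) S7 `hBaseKC ↦` S7′ `hBaseKCL` (conclusion `TCPlus.InvKCL …`; res-type-100); `IsClosed Z₂` from `IsClosed (υ ⁻¹' {x})`;
* (step, kept/raised) `invKC_step_regular/singular ↦ invKCL_step_regular/singular` (res-L1-w45b-stub-4 p573857/p573861, extra `hZcl`), `invK_inv ∘ invKC_invK ↦ invKCL_inv`;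
* (curve) `Tower.inv₂_of_invKC_curveStep_sec / inv₂_of_inv_curveStep_forget_sec ↦ Tower.inv₃_of_invKCL_curveStep_sec / inv₃_of_inv_curveStep_forget_sec` (stub-4 p575309);
* (pt-reg)/(pt-ram) `Tower.towerPt{Reg,Ram}₂_inv₂ ↦ Tower.towerPt{Reg,Ram}₂_inv₃` (stub-4 p573481);
* (round) cone: `Tower.inv₂_coneRound_new_sec ↦ inv₃_coneRound_new_sec` (stub-4 p575273), `inv₂_coneRound_old ↦ inv₃_coneRound_old` and S5
  `subset_closure_diff_of_inv₂_coneWitness ↦ …inv₃…` (stub-4 p575444); Čech: S6 `hCech` binder re-typed `Tower.Inv₂ ↦ Tower.Inv₃` AND given one more antecedent — input (c) at the round's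
  stage `(G, T, Z)` (stub-4's `hFrame` brick shape), PROVED at the call site from the carrier datum through the `DirStepSec` iso — so that the S6 closer twin
  of res-D-pv-057's `Tower.hCech_of_lift_sec` p575157 (stub-4: `Tower.hCech₃_of_lift_sec` over `inv₃_cechRound_new/old` p575645/p575658) needs NO closer-level
  `hFrameAll` (refutable as universally typed); the binder text = that closer's required conclusion;
* (final) `Tower.inv₂_final ↦ Tower.inv₃_final` (…NatTowerInvDefs p570397).
REMAINING STAND-INS = {`hTj : RationalCarrierLift O k θ P q` (residue (T-j); discharged at the closer from F-102 `GenusZeroOverCompleteDVR` via res-L1-type-o6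
`rationalCarrierLift_of_genusZeroOverCompleteDVR` p572358), S6 `hCech` (at `Inv₃`; residual (L) `hLift`, (N3) `hShadow`, (N3′) `hShadowOld`), S7′ `hBaseKCL` (res-type-100)}.
-/


set_option linter.dupNamespace false -- mandated namespace `Summit.<Summit>.<Problem>` of this single-conjunct summit
set_option linter.overlappingInstances false -- signatures carry `[IsDomain O] [IsDiscreteValuationRing O]`

noncomputable section

open CategoryTheory CategoryTheory.Limits AlgebraicGeometry TopologicalSpace Topology IsLocalRing
open Literature.AlgebraicGeometry.Resolution
open AlgebraicGeometry.Scheme.IdealSheafData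
open Literature.AlgebraicGeometry.Morphisms (ProjCech.PP ProjCech.toSpec)
open Summit.ResolutionOfSingularities.ResolutionOfSingularities.Theses.EquisingularLift.Split
open Summit.ResolutionOfSingularities.ResolutionOfSingularities.Cruxes.EquisingularLift.StrataSplit

namespace Summit.ResolutionOfSingularities.ResolutionOfSingularities.Cruxes.EquisingularLiftNat.Sections

/-- **HSUB′(ReachTower₄)₃ — the assembly skeleton v7: the (R1) currency switch `INV := TCPlus.InvKCL`, `INV₁ := Tower.Inv₃`** (see the module docstring
for the stand-ins and the bricks).
[cite: GortzWedhorn2020, Prop. 13.91 and (13.19)] [cite: Liu2002, §8.1 and Thm. 8.1.19] [OURS · L1 W4.5b] toward `stub_elnat_coneTowerPointResolution`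
(stmt-ResolutionOfSingularities-20148 / -20038) via the INST p557863; NOT a statement of the manuscript; AI-written, weaker than expert review. -/
theorem hsub_reachTower_four_of_kcl (k : Type) [Field k] [IsAlgClosed k]
    (O : Type) [CommRing O] [IsDomain O] [IsDiscreteValuationRing O] [IsAdicComplete (IsLocalRing.maximalIdeal O) O]
    [IsAlgClosed (IsLocalRing.ResidueField O)] (θ : O →+* k) (hθ : Function.Surjective θ)
    (P : Scheme.{0}) (q : P ⟶ Spec (.of O)) (Y : Set P) (Ch : ∀ X' : Scheme.{0}, (X' ⟶ P) → Set X' → Prop)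
    (hChStep : ∀ (X' X'' : Scheme.{0}) (σ' : X' ⟶ P) (S' : Set X') (C : X'.IdealSheafData) (τ : X'' ⟶ X'),
      Ch X' σ' S' → IsBlowup τ C → Scheme.IsRegular C.subscheme → Flat (C.subschemeι ≫ σ' ≫ q) →
      σ' '' (C.support : Set X') ⊆ {y | ¬ IsGenericPoint y Y} → (C.support : Set X') ∩ (σ' ≫ q) ⁻¹' {IsLocalRing.closedPoint O} ⊆ S' →
      Ch X'' (τ ≫ σ') (closure (τ ⁻¹' (S' \ (C.support : Set X')))))
    (hChSplit : ∀ (X' : Scheme.{0}) (σ' : X' ⟶ P) (S' : Set X'), Ch X' σ' S' → Chain P Y X' σ' S')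
    (hYsp : Y ⊆ q ⁻¹' {IsLocalRing.closedPoint O}) (hYirr : IsIrreducible Y) (hYcl : IsClosed Y) (hPint : IsIntegral P)
    (hPnoeth : IsLocallyNoetherian P) (hPreg : Scheme.IsRegular P) (hqprop : IsProper q) (hqsm : SmoothOfRelativeDimension 3 q)
    (X' : Scheme.{0}) (σ' : X' ⟶ P) (S' : Set X') (hCh' : Ch X' σ' S') (hX'int : IsIntegral X') (hX'noeth : IsLocallyNoetherian X')
    (hX'reg : Scheme.IsRegular X') (hX'dom : IsDominant (σ' ≫ q)) (F₁ : Scheme.{0}) (hF₁ : IsIntegral F₁) (j : F₁ ⟶ X')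
    (t : F₁ ⟶ Spec (.of k)) (hsq : IsPullback j t (σ' ≫ q) (Spec.map (CommRingCat.ofHom θ))) (T₁ : Set F₁) (hT₁cl : IsClosed T₁)
    (hT₁irr : IsIrreducible T₁) (hjT₁ : j '' T₁ = S') (x : F₁) (hx : IsClosed ({x} : Set F₁)) (U : X'.Opens)
    (hU : Smooth (U.ι ≫ σ' ≫ q)) (s : Spec (.of O) ⟶ X') (hs : s ≫ σ' ≫ q = 𝟙 _) (hsU : s (IsLocalRing.closedPoint O) ∈ U)
    (hsx : s (IsLocalRing.closedPoint O) = j x)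
    (hdim : ringKrullDim (X'.presheaf.stalk (s (IsLocalRing.closedPoint O))) = ((3 + 1 : ℕ) : WithBot ℕ∞))
    (hxreg : IsRegularLocalRing (F₁.presheaf.stalk x)) (hsoff : ∀ c ∈ (s.ker.support : Set X'), ¬ IsGenericPoint (σ' c) Y)
    (X₁ : Scheme.{0}) (τ₁ : X₁ ⟶ X') (hτ₁ : IsBlowup τ₁ s.ker) (hX₁int : IsIntegral X₁) (hX₁noeth : IsLocallyNoetherian X₁)
    (hX₁reg : Scheme.IsRegular X₁) (hX₁dom : IsDominant ((τ₁ ≫ σ') ≫ q)) (F₂ : Scheme.{0}) (hF₂ : IsIntegral F₂) (υ : F₂ ⟶ F₁)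
    (hυ : IsBlowup υ (vanishingIdeal (⟨{x}, hx⟩ : Closeds F₁))) (j₂ : F₂ ⟶ X₁) (t₂ : F₂ ⟶ Spec (.of k))
    (hsq₂ : IsPullback j₂ t₂ ((τ₁ ≫ σ') ≫ q) (Spec.map (CommRingCat.ofHom θ))) (hcomm : j₂ ≫ τ₁ = υ ≫ j)
    (hcarrier : (s.ker.comap τ₁).comap j₂ = (vanishingIdeal (⟨{x}, hx⟩ : Closeds F₁)).comap υ)
    (hirr₂ : IsIrreducible (closure (υ ⁻¹' (T₁ \ {x})))) (hCh₁ : Ch X₁ (τ₁ ≫ σ') (j₂ '' closure (υ ⁻¹' (T₁ \ {x}))))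
    -- ===================== NAMED STAND-INS (shrink as bricks land) =====================
    -- (S1″/d) = residue (T-j): the rational-carrier lift at every `O`-smooth centre of the telescope (res-L1-type-o6 `RationalCarrierLift` p568626)
    (hTj : RationalCarrierLift O k θ P q)
    -- (S6) the Čech-witnessed round at `Tower.Inv₃` (res-D-pv-057 `Tower.hCech_of_lift_sec` p575157 re-pointed at res-L1-w45b-stub-4's
    -- `Tower.inv₃_cechRound_new/old` p575645/p575658; residual (L)/(N3)/(N3′)), at `INV₁`
    (hCech : ∀ {F₉ : Scheme.{0}} (Z₉ : Set F₉) (hZ₉ : IsClosed Z₉) {F₁₀ : Scheme.{0}} (υ' : F₁₀ ⟶ F₉)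
        (G G' : Scheme.{0}) (γ : G ⟶ F₁₀) (T E K : Set G) (hE : IsClosed E) (Z : Set G) (hZ : IsClosed Z) (υ₂ : G' ⟶ G) (K' : Set G'),
        (Tower.Inv₃ O k θ P q Y Ch (DirLift.Ruled O k θ P q Y) F₉ Z₉ hZ₉ F₁₀ υ' G γ T E K ∧ IsClosed K ∧ K ⊆ closure (K \ E) ∧ K ≠ Set.univ) →
        Z ⊆ E ∩ T → Z.Nonempty → TowerFull F₉ F₁₀ υ' Z₉ hZ₉ G γ Z hZ →
        (DirStepSec F₉ F₁₀ υ' Z₉ hZ₉ G γ Z hZ ∧ RationalCarrier (redSub F₉ Z₉ hZ₉) ∧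
          (∀ x : redSub G Z hZ, IsRegularLocalRing (G.presheaf.stalk (redSubι G Z hZ x))) ∧
          (∀ (i : redSub G Z hZ ⟶ redSub G E hE), i ≫ redSubι G E hE = redSubι G Z hZ →
            ∀ x : redSub G Z hZ, IsRegularLocalRing ((redSub G E hE).presheaf.stalk (i x))) ∧ DirStepUnobs G E hE Z hZ) →
        -- input (c) AT THIS ROUND, handed to the S6 closer (v7: DERIVED at the call site from the carrier datum of `INV₁` through the section iso —
        -- replaces the refutable closer-level `hFrameAll` of p575157): quasi-regular 2-frames of every regular `O`-flat centre with trace `𝓘⟨Z⟩`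
        (∀ (X : Scheme.{0}) (σ : X ⟶ P) (S : Set X) (jG : G ⟶ X) (tG : G ⟶ Spec (.of k)) (𝒞 : X.IdealSheafData),
          Ch X σ S → IsIntegral X → IsLocallyNoetherian X → Scheme.IsRegular X → IsDominant (σ ≫ q) →
          IsPullback jG tG (σ ≫ q) (Spec.map (CommRingCat.ofHom θ)) → jG '' T = S →
          𝒞.comap jG = vanishingIdeal ⟨Z, hZ⟩ → Flat (𝒞.subschemeι ≫ σ ≫ q) → Scheme.IsRegular 𝒞.subscheme →
          ∀ x ∈ 𝒞.support, ∃ c : Fin 2 → X.presheaf.stalk x, Ideal.span (Set.range c) = stalkIdeal 𝒞 x ∧ IsQuasiRegular c) →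
        IsBlowup υ₂ (vanishingIdeal (⟨Z, hZ⟩ : Closeds G)) →
        (K' = ∅ ∨ ((ConeWitness G E hE K Z hZ ∨ closure (Z \ closure K) = Z) ∧ K' = closure (υ₂ ⁻¹' (K \ Z)))) →
        (Tower.Inv₃ O k θ P q Y Ch (DirLift.Ruled O k θ P q Y) F₉ Z₉ hZ₉ F₁₀ υ' G' (υ₂ ≫ γ) (closure (υ₂ ⁻¹' (T \ Z))) (υ₂ ⁻¹' Z) K' ∧
            IsClosed K' ∧ K' ⊆ closure (K' \ υ₂ ⁻¹' Z) ∧ K' ≠ Set.univ) ∧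
          (Tower.Inv₃ O k θ P q Y Ch (DirLift.Ruled O k θ P q Y) F₉ Z₉ hZ₉ F₁₀ υ' G' (υ₂ ≫ γ) (closure (υ₂ ⁻¹' (T \ Z))) (closure (υ₂ ⁻¹' (E \ Z))) K' ∧
            IsClosed K' ∧ K' ⊆ closure (K' \ closure (υ₂ ⁻¹' (E \ Z))) ∧ K' ≠ Set.univ))
    -- (S7′) B9 at the `ConeForm` seed with the LOCALIZED shadow trace (vii-loc) (res-type-100: `…NatConeFormConstants` → KCL twin → `hBaseKCL`)
    (hBaseKCL : ∀ W : Set F₁, x ∈ W → ¬ (υ ⁻¹' {x} ⊆ closure (υ ⁻¹' (W \ {x}))) →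
        (∃ U₁ : F₁.affineOpens, x ∈ (U₁ : F₁.Opens) ∧
          ((vanishingIdeal (⟨closure W, isClosed_closure⟩ : Closeds F₁)).ideal U₁).IsPrincipal) →
        ConeForm F₁ x W →
        TCPlus.InvKCL O k θ P q Y Ch W F₂ (𝟙 F₂) (closure (υ ⁻¹' (T₁ \ {x}))) (υ ⁻¹' {x} ∩ closure (υ ⁻¹' (W \ {x})))
          (closure (υ ⁻¹' (W \ {x}))) false) :
    -- ===================== THE CONCLUSION OF HSUB′(ReachTower₄)₃ (revision ₄) =====================
    ∀ (F' : Scheme.{0}) (β : F' ⟶ F₂) (T' : Set F'), ReachTower₄ F₁ F₂ υ x (closure (υ ⁻¹' (T₁ \ {x}))) F' β T' →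
      ∃ (X₉ : Scheme.{0}) (σ₉ : X₉ ⟶ P) (S₉ : Set X₉) (j₉ : F' ⟶ X₉) (t₉ : F' ⟶ Spec (.of k)),
        Ch X₉ σ₉ S₉ ∧ IsIntegral X₉ ∧ IsLocallyNoetherian X₉ ∧ Scheme.IsRegular X₉ ∧ IsDominant (σ₉ ≫ q) ∧
        IsPullback j₉ t₉ (σ₉ ≫ q) (Spec.map (CommRingCat.ofHom θ)) ∧ j₉ '' T' = S₉ ∧ IsClosed T' ∧ IsIrreducible T' ∧ IsIntegral F' := by
  classical
  haveI := hPint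
  haveI := hqprop
  haveI := hqsm
  haveI := hX'int
  haveI := hX'noeth
  haveI := hF₁
  haveI := hX₁int
  haveI := hX₁noeth
  haveI := hF₂
  -- the special fibre of `F₂` over `x`
  have hEx : IsClosed (υ ⁻¹' ({x} : Set F₁)) := hx.preimage υ.continuous
  -- the generic point of `Y` (T-DIM) and input (c) DERIVED: 2-frames of a regular `O`-flat centre on a `Ch`-stage from the carrier datum through a
  -- section iso (res-L1-w45b-stub-3 `forall_exists_twoFrame_of_model_of_carrier`, T-DIM `ringKrullDim_stalk_eq_succ_of_chain`, `chain_isRegular`)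
  obtain ⟨ξ, hξ⟩ : ∃ ξ : P, IsGenericPoint ξ Y := QuasiSober.sober hYirr hYcl
  have hFrameOf : ∀ {G : Scheme.{0}} (T : Set G) (Z : Set G) (hZ : IsClosed Z) {C₉ : Scheme.{0}}
      (_ : ∀ c : C₉, IsClosed ({c} : Set C₉) → ringKrullDim (C₉.presheaf.stalk c) = ((1 : ℕ) : WithBot ℕ∞))
      (δ : redSub G Z hZ ⟶ C₉) [IsIso δ]
      (X : Scheme.{0}) (σ : X ⟶ P) (S : Set X) (jG : G ⟶ X) (tG : G ⟶ Spec (.of k)) (𝒞 : X.IdealSheafData),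
      Ch X σ S → IsIntegral X → IsLocallyNoetherian X → Scheme.IsRegular X → IsDominant (σ ≫ q) →
      IsPullback jG tG (σ ≫ q) (Spec.map (CommRingCat.ofHom θ)) → jG '' T = S →
      𝒞.comap jG = vanishingIdeal ⟨Z, hZ⟩ → Flat (𝒞.subschemeι ≫ σ ≫ q) → Scheme.IsRegular 𝒞.subscheme →
      ∀ x ∈ 𝒞.support, ∃ c : Fin 2 → X.presheaf.stalk x, Ideal.span (Set.range c) = stalkIdeal 𝒞 x ∧ IsQuasiRegular c := by
    intro G T Z hZ C₉ hdimZ₉ δ _ X σ S jG tG 𝒞 hCh _ hXnoeth hXreg _ hsqG _ hCD hCflat hCreg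
    haveI := hXnoeth
    haveI : IsProper σ := (chain_isRegular P Y X σ S (hChSplit X σ S hCh) hPnoeth hPreg).2.2
    haveI : IsProper (σ ≫ q) := inferInstance
    haveI : Flat (𝒞.subschemeι ≫ σ ≫ q) := hCflat
    exact forall_exists_twoFrame_of_model_of_carrier O k θ hθ (σ ≫ q) jG tG hsqG hXreg 𝒞 hCreg hCD (n := 3) (d := 1) rfl
      (fun x _ hxcl hx0 => ringKrullDim_stalk_eq_succ_of_chain q 3 hξ (hChSplit X σ S hCh) hxcl hx0) δ hdimZ₉
  -- input (c)'s carrier datum PROVED at the birth: `TCPlus.Member(KC) … ∅` clause (v) (codimension 2 at the CLOSED special points) + T-DIM, through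
  -- res-L1-w45b-stub-3's `forall_ringKrullDim_stalk_trace_eq_of_codim_over_closedPoint` (…NatCarrierCurveDimension p571497)
  have hcarOf : ∀ {G : Scheme.{0}} (T Z : Set G) (hZ : IsClosed Z)
      (X : Scheme.{0}) (σ : X ⟶ P) (S : Set X) (jG : G ⟶ X) (tG : G ⟶ Spec (.of k)) (𝓢 K : X.IdealSheafData),
      Ch X σ S → IsLocallyNoetherian X → IsPullback jG tG (σ ≫ q) (Spec.map (CommRingCat.ofHom θ)) →
      (𝓢 ⊔ K).comap jG = vanishingIdeal (⟨closure Z, isClosed_closure⟩ : Closeds G) → Flat ((𝓢 ⊔ K).subschemeι ≫ σ ≫ q) →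
      (∀ z ∈ ((𝓢 ⊔ K).support : Set X), (σ ≫ q) z = closedPoint O → z ∉ jG '' (∅ : Set G) →
        IsRegularLocalRing (X.presheaf.stalk z ⧸ stalkIdeal (𝓢 ⊔ K) z) ∧
        (IsClosed ({z} : Set X) → ringKrullDim (X.presheaf.stalk z ⧸ stalkIdeal (𝓢 ⊔ K) z) + 2 = ringKrullDim (X.presheaf.stalk z))) →
      ∀ z : ↥(redSub G Z hZ), IsClosed ({z} : Set ↥(redSub G Z hZ)) →
        ringKrullDim ((redSub G Z hZ).presheaf.stalk z) = ((1 : ℕ) : WithBot ℕ∞) := by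
    intro G T Z hZ X σ S jG tG 𝓢 K hCh hXnoeth hsqG hi hii hv
    haveI := hXnoeth
    haveI : Flat ((𝓢 ⊔ K).subschemeι ≫ σ ≫ q) := hii
    have hc : (⟨closure Z, isClosed_closure⟩ : Closeds G) = ⟨Z, hZ⟩ := Closeds.ext hZ.closure_eq
    rw [hc] at hi
    exact forall_ringKrullDim_stalk_trace_eq_of_codim_over_closedPoint O k θ hθ (σ ≫ q) jG tG hsqG (𝓢 ⊔ K) hi (n := 3) (d := 1) rfl
      (fun x hx hrx hxcl => (hv x hx hrx (by simp)).2 hxcl)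
      (fun x _ hxcl hrx => ringKrullDim_stalk_eq_succ_of_chain q 3 hξ (hChSplit X σ S hCh) hxcl hrx)
  have hcarOfINV : ∀ (W : Set F₁) {F₉ : Scheme.{0}} (β₉ : F₉ ⟶ F₂) (T₉ Z₉ K₉ : Set F₉) (b₉ : Bool) (hZ₉ : IsClosed Z₉),
      ((K₉ = ∅ ∧ TCPlus.Inv O k θ P q Y Ch W F₉ β₉ T₉ Z₉ b₉) ∨
        (TCPlus.InvKCL O k θ P q Y Ch W F₉ β₉ T₉ Z₉ K₉ b₉ ∧ IsClosed K₉ ∧ K₉ ⊆ closure (K₉ \ closure Z₉) ∧ K₉ ≠ Set.univ ∧ IsClosed Z₉)) →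
      ∀ z : ↥(redSub F₉ Z₉ hZ₉), IsClosed ({z} : Set ↥(redSub F₉ Z₉ hZ₉)) →
        ringKrullDim ((redSub F₉ Z₉ hZ₉).presheaf.stalk z) = ((1 : ℕ) : WithBot ℕ∞) := by
    intro W F₉ β₉ T₉ Z₉ K₉ b₉ hZ₉ hI
    rcases hI with ⟨-, -, -, -, -, hmem, -⟩ | ⟨⟨-, -, -, -, hmem, -⟩, -⟩
    · obtain ⟨X, σ, S, jG, tG, 𝓢, K, hCh, -, hXnoeth, -, -, hsqG, -, hi, hii, -, -, -, hv, -⟩ := hmem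
      exact hcarOf T₉ Z₉ hZ₉ X σ S jG tG 𝓢 K hCh hXnoeth hsqG hi hii hv
    · obtain ⟨X, σ, S, jG, tG, 𝓢, K, hCh, -, hXnoeth, -, -, hsqG, -, hi, hii, -, -, -, hv, -, -, -⟩ := hmem
      exact hcarOf T₉ Z₉ hZ₉ X σ S jG tG 𝓢 K hCh hXnoeth hsqG hi hii hv
  refine hsub_reachTower₄_of_invariant k 3 O θ hθ P q Y Ch hChStep hChSplit hYsp hYirr hYcl hPint hPnoeth hPreg hqprop hqsm X' σ'
    S' hCh' hX'int hX'noeth hX'reg hX'dom F₁ hF₁ j t hsq T₁ hT₁cl hT₁irr hjT₁ x hx U hU s hs hsU hsx hdim hxreg hsoff X₁ τ₁ hτ₁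
    hX₁int hX₁noeth hX₁reg hX₁dom F₂ hF₂ υ hυ j₂ t₂ hsq₂ hcomm hcarrier hirr₂ hCh₁
    -- INV (inner) and INV₁ (tower)
    (fun W G β T Z K b => (K = ∅ ∧ TCPlus.Inv O k θ P q Y Ch W G β T Z b) ∨
      (TCPlus.InvKCL O k θ P q Y Ch W G β T Z K b ∧ IsClosed K ∧ K ⊆ closure (K \ closure Z) ∧ K ≠ Set.univ ∧ IsClosed Z))
    (fun F₉ Z₉ hZ₉ F₁₀ υ' G γ T E K => (Tower.Inv₃ O k θ P q Y Ch (DirLift.Ruled O k θ P q Y) F₉ Z₉ hZ₉ F₁₀ υ' G γ T E K ∧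
      IsClosed K ∧ K ⊆ closure (K \ E) ∧ K ≠ Set.univ) ∧
      (∀ z : ↥(redSub F₉ Z₉ hZ₉), IsClosed ({z} : Set ↥(redSub F₉ Z₉ hZ₉)) →
        ringKrullDim ((redSub F₉ Z₉ hZ₉).presheaf.stalk z) = ((1 : ℕ) : WithBot ℕ∞)))
    ?_ ?_ ?_ ?_ ?_ ?_ ?_ ?_
  · -- (base)
    intro W K₂ hxW hnot hWpr hZT hK₂
    rcases hK₂ with rfl | ⟨hcone, rfl⟩
    · exact Or.inl ⟨rfl, inv_base k O θ hθ P q Y Ch hChSplit hPnoeth hPreg X' σ' S' hCh' hX'reg F₁ j t hsq T₁ x hx U hU s hs hsU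
        hsx hdim hsoff X₁ τ₁ hτ₁ hX₁reg hX₁dom F₂ υ hυ j₂ t₂ hsq₂ hcomm hcarrier hCh₁ hirr₂ W hxW hnot hWpr⟩
    · refine Or.inr ⟨hBaseKCL W hxW hnot hWpr hcone, isClosed_closure, ?_, ?_, hEx.inter isClosed_closure⟩
      · -- `υ⁻¹(W ∖ {x})` misses the special fibre, hence the closure of `Z₂ ⊆ υ⁻¹{x}`
        have hZcl : closure (υ ⁻¹' {x} ∩ closure (υ ⁻¹' (W \ {x}))) ⊆ υ ⁻¹' {x} :=
          closure_minimal Set.inter_subset_left hEx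
        refine closure_minimal (fun g hg => subset_closure ⟨subset_closure hg, fun h => hg.2 (hZcl h)⟩) isClosed_closure
      · intro huniv
        apply hnot
        rw [huniv]; exact Set.subset_univ _
  · -- (step, flag kept)
    intro W G₁ G₂ β T Z K b y υ₁ hy hI hyT hyreg' hyreg hυ₁
    rcases hI with ⟨rfl, hI⟩ | hI
    · refine Or.inl ⟨by simp, ?_⟩
      exact inv_step_regular O k θ hθ P q Y hYsp hYirr hYcl hPnoeth hPreg Ch hChSplit hChStep W G₁ G₂ β T Z b y υ₁ hy hI hyT
        hyreg' hyreg hυ₁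
    · obtain ⟨hI, hKcl, hKd, hKne, hZcl⟩ := hI
      have hI₂ := invKCL_step_regular O k θ hθ P q Y hYsp hYirr hYcl hPnoeth hPreg Ch hChSplit hChStep W G₁ G₂ β T Z K b y υ₁ hy hI hZcl hyT
        hyreg' hyreg hυ₁
      obtain ⟨hG₁, -, -, hTZ, -⟩ := TCPlus.invKCL_inv O k θ P q Y Ch hI
      haveI := hG₁
      refine Or.inr ⟨hI₂, isClosed_closure, ?_, ?_, isClosed_closure⟩
      · -- dense off the transported curve: through the blow-up of the point (an isomorphism off it)
        have h := closure_preimage_diff_subset_of_isBlowup υ₁ _ hυ₁ K (closure Z) isClosed_closure hKd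
        rw [Scheme.IdealSheafData.coe_support_vanishingIdeal] at h
        refine h.trans (closure_mono fun g hg => ⟨hg.1, fun hg' => hg.2 ?_⟩)
        rw [closure_closure] at hg'
        refine closure_mono (Set.preimage_mono ?_) hg'
        intro z hz
        exact ⟨subset_closure hz.1, hz.2⟩
      · have hyZ : ((vanishingIdeal (⟨closure Z, isClosed_closure⟩ : Closeds G₁)).subschemeι y : G₁) ∈ closure Z := by
          have h1 : ((vanishingIdeal (⟨closure Z, isClosed_closure⟩ : Closeds G₁)).subschemeι y : G₁) ∈
              Set.range (vanishingIdeal (⟨closure Z, isClosed_closure⟩ : Closeds G₁)).subschemeι := ⟨y, rfl⟩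
          rw [Scheme.IdealSheafData.range_subschemeι, Scheme.IdealSheafData.coe_support_vanishingIdeal] at h1
          exact h1
        exact closure_preimage_ne_univ υ₁ _ hυ₁ K {_} hKcl hKne hy
          (fun h => hTZ (fun z _ => by rw [Set.eq_univ_iff_forall] at h; rw [Set.mem_singleton_iff.mp (h z)]; exact hyZ))
          (by rw [Scheme.IdealSheafData.coe_support_vanishingIdeal]; rfl) _ (Set.preimage_mono fun z hz => hz.1)
  · -- (step, flag raised)
    intro W G₁ G₂ β T Z K y υ₁ hy hI hyT hysing hyreg hυ₁
    rcases hI with ⟨rfl, hI⟩ | hI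
    · refine Or.inl ⟨by simp, ?_⟩
      exact inv_step_singular O k θ hθ P q Y hYsp hYirr hYcl hPnoeth hPreg Ch hChSplit hChStep W G₁ G₂ β T Z y υ₁ hy hI hyT
        hysing hyreg hυ₁
    · obtain ⟨hI, hKcl, hKd, hKne, hZcl⟩ := hI
      have hI₂ := invKCL_step_singular O k θ hθ P q Y hYsp hYirr hYcl hPnoeth hPreg Ch hChSplit hChStep W G₁ G₂ β T Z K y υ₁ hy hI hZcl hyT
        hysing hyreg hυ₁
      obtain ⟨hG₁, -, -, hTZ, -⟩ := TCPlus.invKCL_inv O k θ P q Y Ch hI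
      haveI := hG₁
      refine Or.inr ⟨hI₂, isClosed_closure, ?_, ?_, isClosed_closure⟩
      · have h := closure_preimage_diff_subset_of_isBlowup υ₁ _ hυ₁ K (closure Z) isClosed_closure hKd
        rw [Scheme.IdealSheafData.coe_support_vanishingIdeal] at h
        refine h.trans (closure_mono fun g hg => ⟨hg.1, fun hg' => hg.2 ?_⟩)
        rw [closure_closure] at hg'
        refine closure_mono (Set.preimage_mono ?_) hg'
        intro z hz
        exact ⟨subset_closure hz.1, hz.2⟩
      · have hyZ : ((vanishingIdeal (⟨closure Z, isClosed_closure⟩ : Closeds G₁)).subschemeι y : G₁) ∈ closure Z := by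
          have h1 : ((vanishingIdeal (⟨closure Z, isClosed_closure⟩ : Closeds G₁)).subschemeι y : G₁) ∈
              Set.range (vanishingIdeal (⟨closure Z, isClosed_closure⟩ : Closeds G₁)).subschemeι := ⟨y, rfl⟩
          rw [Scheme.IdealSheafData.range_subschemeι, Scheme.IdealSheafData.coe_support_vanishingIdeal] at h1
          exact h1
        exact closure_preimage_ne_univ υ₁ _ hυ₁ K {_} hKcl hKne hy
          (fun h => hTZ (fun z _ => by rw [Set.eq_univ_iff_forall] at h; rw [Set.mem_singleton_iff.mp (h z)]; exact hyZ))
          (by rw [Scheme.IdealSheafData.coe_support_vanishingIdeal]; rfl) _ (Set.preimage_mono fun z hz => hz.1)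
  · -- (curve)
    intro W F₉ β₉ T₉ Z₉ K₉ b₉ hZ₉ F₁₀ υ' hI hZT hTZ hZinf _hfin hυ'
    have hcar := hcarOfINV W β₉ T₉ Z₉ K₉ b₉ hZ₉ hI
    rcases hI with ⟨hK, hI⟩ | ⟨hI, hKcl, hKd, hKne, -⟩
    · have h := Tower.inv₃_of_inv_curveStep_forget_sec O k θ hθ P q Y hYsp hYirr hYcl hPnoeth hPreg Ch hChSplit hChStep W F₉ β₉ T₉ Z₉ K₉ b₉
        hZ₉ F₁₀ υ' hI hZinf hK hZT hTZ hυ' (fun X σ S jG tG 𝒞 h₁ h₂ h₃ h₄ h₅ h₆ h₇ h₈ h₉ h₁₀ =>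
          hFrameOf T₉ Z₉ hZ₉ hcar (𝟙 _) X σ S jG tG 𝒞 h₁ h₂ h₃ h₄ h₅ h₆ h₇ h₈ h₉ h₁₀) hTj
      subst hK
      refine ⟨⟨h, isClosed_closure, by simp, ?_⟩, hcar⟩
      obtain ⟨-, -, hF₁₀, -⟩ := h
      haveI := hF₁₀
      rw [show closure (υ' ⁻¹' (∅ \ Z₉)) = ∅ by simp]
      exact Set.empty_ne_univ
    · obtain ⟨hG, -⟩ := TCPlus.invKCL_inv O k θ P q Y Ch hI
      haveI := hG
      have h := Tower.inv₃_of_invKCL_curveStep_sec O k θ hθ P q Y hYsp hYirr hYcl hPnoeth hPreg Ch hChSplit hChStep W F₉ β₉ T₉ Z₉ K₉ b₉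
        hZ₉ F₁₀ υ' hI hZinf hKcl hKne (hKd.trans (closure_mono fun z hz => ⟨hz.1, fun h => hz.2 (subset_closure h)⟩)) hZT hTZ hυ'
        (fun X σ S jG tG 𝒞 h₁ h₂ h₃ h₄ h₅ h₆ h₇ h₈ h₉ h₁₀ =>
          hFrameOf T₉ Z₉ hZ₉ hcar (𝟙 _) X σ S jG tG 𝒞 h₁ h₂ h₃ h₄ h₅ h₆ h₇ h₈ h₉ h₁₀) hTj
      refine ⟨⟨h, isClosed_closure, ?_, ?_⟩, hcar⟩
      · have := closure_preimage_diff_subset_closure_diff_preimage υ' K₉ Z₉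
        exact this
      · obtain ⟨-, -, -, hTcl, hTirr, -⟩ := h
        refine closure_preimage_ne_univ υ' _ hυ' K₉ Z₉ hKcl hKne hZ₉ (fun h => hTZ (h ▸ Set.subset_univ _))
          (by rw [Scheme.IdealSheafData.coe_support_vanishingIdeal]; rfl) _ (Set.preimage_mono fun z hz => hz.1)
  · -- (pt-reg)
    intro F₉ Z₉ hZ₉ F₁₀ υ' G G' γ T E K y υ₂ hy K' E' hinv hTreg hGreg hυ₂ hK' hE'
    obtain ⟨⟨hinv, hKcl, hKE, hKne⟩, hcar⟩ := hinv
    have hI₂ := Tower.towerPtReg₂_inv₃ O k θ hθ P q Y hYsp hYirr hYcl hPnoeth hPreg Ch hChSplit hChStep (DirLift.Ruled O k θ P q Y) F₉ Z₉ hZ₉ F₁₀ υ'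
      (DirLift.ruled_of_step_away O k θ P q Y F₉ Z₉ hZ₉ F₁₀ υ') G G' γ T E K y υ₂ hy K' E' hinv hTreg hGreg hυ₂ hK' hE'
    refine (fun h3 => ⟨⟨hI₂, h3⟩, hcar⟩) ?_
    obtain ⟨-, -, hGint, -, hTirr, hEcl, hTE, -⟩ := hinv
    obtain ⟨-, -, hG'int, -⟩ := hI₂
    haveI := hGint
    haveI := hG'int
    have hTy : ¬ T ⊆ {curvePt G T y} := not_subset_singleton_of_not_isRegularLocalRing_stalk y hTreg hy
    have hDsupp : ((vanishingIdeal (⟨{curvePt G T y}, hy⟩ : Closeds G) : G.IdealSheafData).support : Set G) = {curvePt G T y} :=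
      Scheme.IdealSheafData.coe_support_vanishingIdeal _
    rcases hK' with rfl | ⟨hyK, rfl⟩
    · exact ⟨isClosed_empty, by simp, Set.empty_ne_univ⟩
    · refine ⟨isClosed_closure, ?_, closure_preimage_ne_univ υ₂ _ hυ₂ K {curvePt G T y} hKcl hKne hy
        (fun h => hTy (h ▸ Set.subset_univ _)) hDsupp.le _ (Set.preimage_mono fun z hz => hz.1)⟩
      rcases hE' with rfl | ⟨-, rfl⟩
      · exact closure_preimage_diff_subset_closure_diff_preimage υ₂ K {curvePt G T y}
      · have h := closure_preimage_diff_subset_of_isBlowup υ₂ (vanishingIdeal (⟨{curvePt G T y}, hy⟩ : Closeds G)) hυ₂ K E hEcl hKE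
        rw [hDsupp] at h
        exact h
  · -- (pt-ram)
    intro F₉ Z₉ hZ₉ F₁₀ υ' G G' γ T E K y J υ₂ K' E' hinv hTreg hGreg hJsupp hJgen hυ₂ hK' hE'
    obtain ⟨⟨hinv, hKcl, hKE, hKne⟩, hcar⟩ := hinv
    have hI₂ := Tower.towerPtRam₂_inv₃ O k θ hθ P q Y hYsp hYirr hYcl hPnoeth hPreg Ch hChSplit hChStep (DirLift.Ruled O k θ P q Y) F₉ Z₉ hZ₉ F₁₀ υ'
      (DirLift.ruled_of_step_away O k θ P q Y F₉ Z₉ hZ₉ F₁₀ υ') G G' γ T E K y J υ₂ K' E' hinv hTreg hGreg hJsupp hJgen hυ₂ hK' hE'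
    refine (fun h3 => ⟨⟨hI₂, h3⟩, hcar⟩) ?_
    obtain ⟨-, -, hGint, -, hTirr, hEcl, hTE, -⟩ := hinv
    obtain ⟨-, -, hG'int, -⟩ := hI₂
    haveI := hGint
    haveI := hG'int
    have hyc : IsClosed ({curvePt G T y} : Set G) := hJsupp ▸ J.support.isClosed
    have hTy : ¬ T ⊆ {curvePt G T y} := not_subset_singleton_of_not_isRegularLocalRing_stalk y hTreg hyc
    rcases hK' with rfl | ⟨hyK, rfl⟩
    · exact ⟨isClosed_empty, by simp, Set.empty_ne_univ⟩
    · refine ⟨isClosed_closure, ?_, closure_preimage_ne_univ υ₂ _ hυ₂ K {curvePt G T y} hKcl hKne hyc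
        (fun h => hTy (h ▸ Set.subset_univ _)) hJsupp.le _ (Set.preimage_mono fun z hz => hz.1)⟩
      rcases hE' with rfl | ⟨-, rfl⟩
      · exact closure_preimage_diff_subset_closure_diff_preimage υ₂ K {curvePt G T y}
      · have h := closure_preimage_diff_subset_of_isBlowup υ₂ J hυ₂ K E hEcl hKE
        rw [hJsupp] at h
        exact h
  · -- (round) at revision ₄ and `Tower.Inv₃`: Čech ↦ S6 `hCech`; cone ↦ stub-4's `inv₃_coneRound_new_sec` p575273 + `inv₃_coneRound_old` with S5 :=
    -- `subset_closure_diff_of_inv₃_coneWitness` p575444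
    intro F₉ Z₉ hZ₉ F₁₀ υ' G G' γ T E K hE Z hZ υ₂ K' hinv hZET hZne hfull hsec hwit hυ₂ hK'
    rcases hwit with hcech | hcone
    · obtain ⟨δ, _, hδiso⟩ := id hsec
      haveI := hδiso
      have h := hCech Z₉ hZ₉ υ' G G' γ T E K hE Z hZ υ₂ K' hinv.1 hZET hZne hfull ⟨hsec, hcech⟩
        (fun X σ S jG tG 𝒞 h₁ h₂ h₃ h₄ h₅ h₆ h₇ h₈ h₉ h₁₀ => hFrameOf T Z hZ hinv.2 δ X σ S jG tG 𝒞 h₁ h₂ h₃ h₄ h₅ h₆ h₇ h₈ h₉ h₁₀) hυ₂ hK'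
      exact ⟨⟨h.1, hinv.2⟩, ⟨h.2, hinv.2⟩⟩
    · obtain ⟨⟨hinv₂, hKcl, hKE, hKne⟩, hcar⟩ := hinv
      obtain ⟨δ, _, hδiso⟩ := id hsec
      haveI := hδiso
      have hGint : IsIntegral G := hinv₂.2.2.1
      have hEcl : IsClosed E := hinv₂.2.2.2.2.2.1
      have hTE : ¬ T ⊆ E := hinv₂.2.2.2.2.2.2.1
      haveI := hGint
      have hK'' : K' = ∅ ∨ K' = closure (υ₂ ⁻¹' (K \ Z)) := by
        rcases hK' with h | ⟨-, h⟩
        · exact Or.inl h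
        · exact Or.inr h
      have hZE : Z ⊆ E := fun z hz => (hZET hz).1
      have hZsupp : ((vanishingIdeal (⟨Z, hZ⟩ : Closeds G) : G.IdealSheafData).support : Set G) = Z :=
        Scheme.IdealSheafData.coe_support_vanishingIdeal _
      have hnew := Tower.inv₃_coneRound_new_sec O k θ hθ P q Y hYsp hYirr hYcl hPnoeth hPreg Ch hChSplit hChStep Z₉ hZ₉ υ' G G' γ T E K
        hE Z hZ υ₂ hinv₂ hZET hZne hsec hcone hυ₂ hKcl hKE hKne (fun X σ S jG tG 𝒞 h₁ h₂ h₃ h₄ h₅ h₆ h₇ h₈ h₉ h₁₀ =>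
          hFrameOf T Z hZ hcar δ X σ S jG tG 𝒞 h₁ h₂ h₃ h₄ h₅ h₆ h₇ h₈ h₉ h₁₀) hTj K' hK''
      have hold := Tower.inv₃_coneRound_old O k θ hθ P q Y hYirr hYcl hPnoeth hPreg Ch hChSplit hChStep (DirLift.Ruled O k θ P q Y) Z₉ hZ₉ υ' G G' γ T E K
        hE Z hZ υ₂ hinv₂ hZET hZne hfull hcone hυ₂ hKcl hKE
        (Tower.subset_closure_diff_of_inv₃_coneWitness O k θ hθ P q Y Ch (DirLift.Ruled O k θ P q Y) Z₉ hZ₉ υ' G γ T E K hE Z hZ hinv₂ hfull hZE hcone)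
        (fun X σ jG 𝓔 𝒦 X'' τ j₂ t₂ _ _ hcomm _ he h => by
          obtain ⟨e, he⟩ := he
          exact DirLift.ruled_comp h τ υ₂ j₂ hcomm _ e he _) K' hK''
      have hG'int : IsIntegral G' := hnew.2.2.1
      haveI := hG'int
      have hTZ : ¬ T ⊆ Z := fun h => hTE (h.trans hZE)
      rcases hK'' with rfl | rfl
      · exact ⟨⟨⟨hnew, isClosed_empty, Set.empty_subset _, Set.empty_ne_univ⟩, hcar⟩, ⟨⟨hold, isClosed_empty, Set.empty_subset _,
          Set.empty_ne_univ⟩, hcar⟩⟩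
      · have hne : closure (υ₂ ⁻¹' (K \ Z)) ≠ Set.univ :=
          closure_preimage_ne_univ υ₂ _ hυ₂ K Z hKcl hKne hZ (fun h => hTZ (h ▸ Set.subset_univ _)) hZsupp.le _
            (Set.preimage_mono fun z hz => hz.1)
        refine ⟨⟨⟨hnew, isClosed_closure, closure_preimage_diff_subset_closure_diff_preimage υ₂ K Z, hne⟩, hcar⟩,
          ⟨⟨hold, isClosed_closure, ?_, hne⟩, hcar⟩⟩
        have h := closure_preimage_diff_subset_of_isBlowup υ₂ (vanishingIdeal (⟨Z, hZ⟩ : Closeds G)) hυ₂ K E hEcl hKE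
        rw [hZsupp] at h
        exact h
  · -- (final)
    intro F₉ Z₉ hZ₉ F₁₀ υ' G γ T E K h
    exact Tower.inv₃_final O k θ P q Y Ch (DirLift.Ruled O k θ P q Y) F₉ Z₉ hZ₉ F₁₀ υ' G γ T E K h.1.1

end Summit.ResolutionOfSingularities.ResolutionOfSingularities.Cruxes.EquisingularLiftNat.Sections

end
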